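import Literature.MathematicalPhysics.QuantumFieldTheory.Balaban1983to89.B2Eq228Conditioning
import Literature.MathematicalPhysics.QuantumFieldTheory.Balaban1983to89.B2Eq224FirstStepFields

/-!
# `Balaban1983to89.B2Eq234Exponent` — [Balaban1982Higgs2] (2.34) p. 564, part 1 of 3: the two EXPONENTS of the density
`ρ″^{(1),L}(Λ₀, B, θ₁B^{(1)}, ψ)` (the main quadratic form, and the second representation's exponent term by term —
Dirichlet-restricted form, the two `st(Λ₅)` boundary sums, (2.27)'s bracket `⟨B, Δ^{(1),L}_{Λ₅}B⟩`) and the pointwise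
completed-square identity between them, PROVED in the finite-dimensional Gaussian model of `…B2Eq228Conditioning`
(the integral identity (2.34) itself is part 2, `…B2Eq234SecondRepr`; the lattice/vector-field instance part 3,
`…B2Eq234Lattice`)

statement-level skeleton of published theorems with citation tags; proofs where landed; nothing here is a claim about the Yang–Mills mass gap

PDF held: `paper:balaban1982-cmp86-higgs23-ii` (T. Bałaban, *(Higgs)₂,₃ quantum fields in a finite volume. II. An upper
bound*, Commun. Math. Phys. **86** (1982) 555–594, doi 10.1007/bf01214890; journal page = PDF page + 554); pp. 562–565
[PDF 8–11] READ AS IMAGES on the ×2 renders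
`run/shared/lean/pub/pub-balaban/b2b-balaban-ref1/pages/1982-cmp86-higgs23-II/1982-cmp86-higgs23-II-p008-x2.png` … `-p011-x2.png`;
part I [Balaban1982Higgs1] p. 611 [PDF 9] (the Dirichlet covariances (2.32)) on `…/1982-cmp85-higgs23-I/1982-cmp85-higgs23-I-p009-x2.png`.

CITATION HEADER — WHAT IS REPRODUCED.  SKELETON row **B2.Eq2.42** ((2.20)–(2.42), `absent` head; members landed so far:
(2.20)–(2.21) `…B2Eq220CovDerivSplit`, (2.28)–(2.29) `…B2Eq228Conditioning`; (2.18)–(2.19) = row B2.Eq2.18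
`…B2Eq218Translation`; (2.23)/(2.24)/(2.27) r02 g3 and (2.41)/(2.42) r14 g4 in flight) — THIS FILE and its two sequels:
member **(2.34)** p. 564 (both representations of `ρ″^{(1),L}` and the p. 565 sentence *"The second representation in (2.34)
was obtained by integration with respect to A↾_{Λ₅}, φ↾_{Λ₅}"*), with (2.30) p. 563 in components as a rider (part 2).
Unit `lit-balaban-p15` gen 3 (Phase-2 proof seat p15; HOME `run/shared/lean/pub/lit-balaban/`, seat dir `lit-balaban-p15/`);
B2 fold owner r02, second reader r14; referee ref-4.

THE PRINTED TEXT (p. 564 [PDF 10], verbatim; `st(Λ₅)`, `∂Λ₅` as on p. 563: *"∂Λ₅ = {x ∈ Λ₅ᶜ : x = b₊ for some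
b ∈ st(Λ₅)}"*).  *"As a result of all the operations which have been done up to now, we get the inequality
(2.1) ≦ Σ_{Λ₀} ρ″^{(1),L}(Λ₀, B, θ₁B^{(1)}, ψ)·exp(𝒫^{(1),L}(Λ₇, B^{(1)}, ψ) + O(ε^{κ₀})|Λ₇ᶜ| + O(ε^κ)|T₁|), (2.33) with
κ₀ > 0, κ > d, and ρ″^{(1),L} given by the formulas
ρ″^{(1),L}(Λ₀, B, θ₁B^{(1)}, ψ) = :χ₁∫dA∫dφ ζ_{Λ₀}χ_{Λ₋₁∩Λ₅ᶜ}·exp[−½aL^{d−2}Σ_{y∈T′₁}|B(y) − (QA)(y)|² − ½⟨A, (−Δ + μ₀²ε²)A⟩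
  − ½aL^{d−2}Σ_{y∈T′₁}|ψ(y) − (Q(B̃^{(1)})φ)(y)|² − ½⟨φ, (−Δ_{B̃^{(1)}} + m²ε²)φ⟩]
 = χ₁∫dA↾_{Λ₅ᶜ}∫dφ↾_{Λ₅ᶜ} ζ_{Λ₀}χ_{Λ₋₁∩Λ₅ᶜ}·exp[−½aL^{d−2}Σ_{y∈Λ₅ᶜ}|B(y) − (QA)(y)|² − ½⟨A, (−Δ^D_{Λ₅ᶜ} + μ₀²ε²)A⟩
  − ½aL^{d−2}Σ_{y∈Λ₅ᶜ}|ψ(y) − (Q(B̃^{(1)})φ)(y)|² − ½⟨φ, (−Δ^D_{B̃^{(1)},Λ₅ᶜ} + m²ε²)φ⟩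
  + ½Σ_{b,b′∈st(Λ₅)} A(b₊)·C^{(0)}_{Λ₅}(b₋, b′₋)A(b′₊) + aL⁻²Σ_{b∈st(Λ₅)} A(b₊)·(C^{(0)}_{Λ₅}Q*B)(b₋) − ½⟨B, Δ^{(1),L}_{Λ₅}B⟩
  + ½Σ_{b,b′∈st(Λ₅)} φ(b₊)·U(B^{(1)}_{−b})C^{(0)}_{Λ₅}(B^{(1)}; b₋, b′₋)U(B^{(1)}_{b′})φ(b′₊)
  + aL⁻²Σ_{b∈st(Λ₅)} φ(b₊)·U(B^{(1)}_{−b})(C^{(0)}_{Λ₅}(B^{(1)})Q*(B^{(1)})ψ)(b₋) − ½⟨ψ, Δ^{(1),L}_{Λ₅}(B^{(1)})ψ⟩]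
  ·∫dA↾_{Λ₅} exp(−½⟨A, (C^{(0)}_{Λ₅})⁻¹A⟩)·∫dφ↾_{Λ₅} exp(−½⟨φ, (C^{(0)}_{Λ₅}(B^{(1)}))⁻¹φ⟩).   (2.34)
Because the first representation on the right side above was obtained by doing the translations in the fields A′, φ′
inverse to (2.18), (2.23), we have B̃^{(1)} = (1 − θ₁)A + θ₁B^{(1)}, (2.35) and the characteristic functions
χ_{Λ₋₁∩Λ₅ᶜ} give the restrictions on the fields B, ψ, A, φ on the set Λ₋₁∩Λ₅ᶜ. The functions χ₁ and ζ_{Λ₀} have the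
same meaning as before."*  p. 565 [PDF 11]: *"The second representation in (2.34) was obtained by integration with respect
to A↾_{Λ₅}, φ↾_{Λ₅}."*  The bracket `⟨·, Δ^{(1),L}_Λ ·⟩` is (2.27) p. 562, verbatim: *"⟨ψ, Δ^{(k+1),L}_Λ(Ω, A)ψ⟩ =
aL^{d−2}Σ_{y∈Λ′}|ψ(y)|² − a²L⁻⁴⟨ψ, Q(A)C^{(k)}_Λ(Ω, A)Q*(A)ψ⟩, Λ ⊂ Ω^{(k)}, (2.27) and the similar formula holds for the
vector field."*  The Dirichlet covariances are part I (2.32) p. 611, verbatim: *"For an operator A defined on configurations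
φ : Ω^{(k)} → R^N we define A↾_Λ as an operator on configurations φ : Λ → R^N by the formula A↾_Λφ = ΛAΛφ. We will use the
following covariances also C^{(k)}_Λ(Ω, A) = ((aL⁻²P(A) + Δ^{(k)}(Ω, A))↾_Λ)⁻¹. (2.32) Here we will assume that the set Λ
is a union of big blocks of T₁^{(k)}."*

THE MODEL (one field species at a time; the two species of (2.34) are the same identity for the `A`- and for the
`φ`-integration — the first representation's exponent is the SUM of an `A`-part and a `φ`-part and the weight
`ζ_{Λ₀}χ_{Λ₋₁∩Λ₅ᶜ}` depends on the fields outside `Λ₅` only; the joint double integral is `…B2Eq234SecondRepr.secondRepr_pair`).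
As in `…B2Eq228Conditioning`: `T₁` (× field components) ↦ a finite type `S`, `Λ₅` ↦ a decidable predicate `p` (`In p`/`Out p`,
`glue`, `resIn`/`resOut`, the blocks `blkIn`/`blkMix`/`blkOut` of a matrix); the block lattice `T′₁` (× components) ↦ a
finite type `T` with `Λ′₅` ↦ `pT`; the averaging operator through its kernel `Qm : Matrix S T ℝ` — `(Q*B)(s) = Σ_t Qm s t·B t`,
`(QA)(t) = (QmᵀA)(t)`; for the vector field `Qm = B2Eq218Translation.qstar w blk` (r02's matrix coordinates, `w` ↤ `L^{−d}`,
`blk` ↤ the block map; part 3), for the scalar field the same kernel with the parallel transports `U(B̃^{(1)}(Γ_{y,x}))` as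
entries; *"Λ is a union of big blocks"* (I (2.32)) ↦ the support hypothesis `hQ : Qm s t ≠ 0 → (p s ↔ pT t)`; `κ` ↤ `aL^{d−2}`,
so that `κ·(Qm B)` ↤ `aL⁻²Q*B` (`κ·L^{−d} = aL⁻²`: the print's `Q*` carries no `L^{−d}`, `qstar` does) and `κ·Qm·Qmᵀ` ↤
`aL⁻²Q*Q = aL⁻²P`; `D : Matrix S S ℝ` ↤ `−Δ + μ₀²ε²` (vector) resp. `−Δ_{B̃^{(1)}} + m²ε²` (scalar, components coupled across
a bond `b` by `−U(B̃^{(1)}_b)`); `mainOp κ Qm D = D + κ·Qm·Qmᵀ` ↤ `aL⁻²P + Δ^{(0)}`, the matrix of the main quadratic form,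
so that `C^{(0)}_{Λ₅}` ↦ `cov p 𝒜 = (blkIn p 𝒜)⁻¹` (I (2.32): `𝒜↾_Λ = Λ𝒜Λ` = `blkIn`); `−Δ^D_{Λ₅ᶜ} + μ₀²ε²` ↦ `blkOut p D`,
i.e. the form of the field EXTENDED BY ZERO into `Λ₅` (`quadForm_blkOut`); `st(Λ₅)` ↦ a finite set `st` of pairs
`(b₋, b₊) ∈ Λ₅ × Λ₅ᶜ` supporting the `Λ₅Λ₅ᶜ`-block of `D` (`hst`), with couplings `D(b₋, b₊) = −u_b` (`u_b = 1` for the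
vector field — (2.29) —, an entry of `U(B^{(1)}_b)` for the scalar field — (2.30)).

WHAT IS KERNEL-CHECKED HERE (zero `sorry`, standard axioms).  `cov` = `C^{(0)}_Λ` with `inv_cov` (`(C^{(0)}_Λ)⁻¹ = 𝒜↾_Λ`,
the operator printed in the last line of (2.34)); the boundary sums `bdryQuad`, `bdryLin` and their origin in the completed
square (`half_quad_blkMix_eq`, `neg_lin_blkMix_eq`); the main form `firstExp` = `e^{−½κΣ_tB_t²}`-constant + Gaussian weight
+ source (`firstExp_eq`, `exp_firstExp`); block bookkeeping under `hQ` (`avg_glue_of_in/out`, `blkMix_avg`,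
`blkMix_mainOp`); the Dirichlet reading `quadForm_blkOut` (I (2.32)); (2.27)'s bracket `form227` and the second exponent
`secondExp` (DEFINITIONS WITH BODIES, printed terms one by one); **`exponent_identity`**: at exterior field `y = A↾_{Λ₅ᶜ}`,
`−½κΣ_tB_t² + [−½⟨y,𝒜_{ΛᶜΛᶜ}y⟩ + ⟨f↾_{Λᶜ},y⟩ + ½⟨j(y), C^{(0)}_{Λ₅}j(y)⟩] = secondExp(B, y)`, `f = κQmB`, `j(y) = 𝒜_{ΛΛᶜ}y − f↾_Λ`
(the `cOut`/`jIn` of `…B2Eq228Conditioning`).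
HONEST SCOPE.  The sets Λ₀ ⊃ … ⊃ Λ₇, θ₁, ζ and the characteristic functions are not constructed (they enter through the
weight and the locality `hQ`/`hst`); `form227` carries (2.27)'s printed BODY in these coordinates and IS the quadratic form of
r02's B2-located operator `B2Eq224FirstStepFields.delta227` (row B2.Eq2.42 member (2.27), p248319) at `c = κ`, `Λ′ = Λ′₅`,
`Q = Qmᵀ`, `Qs = Qm`, `CΛ` = `C^{(0)}_{Λ₅}` extended by zero, weight `w = 1` — `form227_eq_delta227`.
-/

open MeasureTheory Matrix Finset
open scoped BigOperators

namespace Literature.MathematicalPhysics.QuantumFieldTheory.Balaban1983to89.B2Eq234Exponent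

open B2Eq228Conditioning

variable {S : Type} [Fintype S] (p : S → Prop) [DecidablePred p]

/-! ## §1 `C^{(0)}_Λ = (𝒜↾_Λ)⁻¹` (part I (2.32)) -/

omit [Fintype S] [DecidablePred p] in
/-- A real positive definite matrix is symmetric. [folklore] [cite: Balaban1982Higgs2, (2.34) p.564] -/
theorem isSymm_of_posDef {𝒜 : Matrix S S ℝ} (h𝒜 : 𝒜.PosDef) : 𝒜.IsSymm := by
  have h := h𝒜.isHermitian.eq
  rwa [conjTranspose_eq_transpose_of_trivial] at h

omit [Fintype S] [DecidablePred p] in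
/-- `𝒜↾_Λ = Λ𝒜Λ` is positive definite with `𝒜`. [folklore] [cite: Balaban1982Higgs1, (2.32) p.611] -/
theorem posDef_blkIn {𝒜 : Matrix S S ℝ} (h𝒜 : 𝒜.PosDef) : (blkIn p 𝒜).PosDef := by
  unfold blkIn
  exact h𝒜.submatrix Subtype.val_injective

variable [DecidableEq S]

/-- **`C^{(0)}_Λ := (𝒜↾_Λ)⁻¹`**, part I (2.32) p. 611: *"A↾_Λφ = ΛAΛφ … C^{(k)}_Λ(Ω, A) = ((aL⁻²P(A) + Δ^{(k)}(Ω, A))↾_Λ)⁻¹"*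
— the covariance with Dirichlet boundary conditions outside `Λ`, for the matrix `𝒜` ↤ `aL⁻²P + Δ^{(0)}` of the main
quadratic form (`blkIn p 𝒜` = the principal `Λ × Λ` submatrix). [cite: Balaban1982Higgs1, (2.32) p.611] -/
noncomputable def cov (𝒜 : Matrix S S ℝ) : Matrix (In p) (In p) ℝ := (blkIn p 𝒜)⁻¹

/-- `(C^{(0)}_Λ)⁻¹ = 𝒜↾_Λ` — the operator in the last line of (2.34), *"exp(−½⟨A, (C^{(0)}_{Λ₅})⁻¹A⟩)"*, is the
restricted main quadratic form (`𝒜` positive definite). [cite: Balaban1982Higgs2, (2.34) p.564] -/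
theorem inv_cov {𝒜 : Matrix S S ℝ} (h𝒜 : 𝒜.PosDef) : (cov p 𝒜)⁻¹ = blkIn p 𝒜 := by
  rw [cov, nonsing_inv_nonsing_inv]
  exact isUnit_iff_ne_zero.2 (posDef_blkIn p h𝒜).det_pos.ne'

/-- `C^{(0)}_Λ` is symmetric (`𝒜` positive definite). [folklore] [cite: Balaban1982Higgs1, (2.32) p.611] -/
theorem isSymm_cov {𝒜 : Matrix S S ℝ} (h𝒜 : 𝒜.PosDef) : (cov p 𝒜).IsSymm := by
  have h : (blkIn p 𝒜).IsSymm := by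
    ext i j
    simp only [blkIn, submatrix_apply, transpose_apply]
    exact (isSymm_of_posDef h𝒜).apply i.1 j.1
  exact h.inv

/-! ## §2 The boundary sums of (2.34): `st(Λ₅)`-supported couplings -/

/-- The quadratic boundary term of (2.34), `½Σ_{b,b′∈st(Λ₅)} y(b₊)·u_b·C(b₋, b′₋)·u_{b′}·y(b′₊)` (vector field: `u ≡ 1`,
*"½Σ_{b,b′∈st(Λ₅)} A(b₊)·C^{(0)}_{Λ₅}(b₋, b′₋)A(b′₊)"*; scalar field: `u_b` = the entries of `U(B^{(1)}_b)`,
*"½Σ φ(b₊)·U(B^{(1)}_{−b})C^{(0)}_{Λ₅}(B^{(1)}; b₋, b′₋)U(B^{(1)}_{b′})φ(b′₊)"*). [cite: Balaban1982Higgs2, (2.34) p.564] -/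
noncomputable def bdryQuad (C : Matrix (In p) (In p) ℝ) (st : Finset (In p × Out p)) (u : In p × Out p → ℝ)
    (y : Out p → ℝ) : ℝ :=
  (1 / 2 : ℝ) * ∑ b ∈ st, ∑ b' ∈ st, y b.2 * u b * C b.1 b'.1 * u b' * y b'.2

/-- The linear boundary term of (2.34), `Σ_{b∈st(Λ₅)} y(b₊)·u_b·(C g)(b₋)` with `g` ↤ `aL⁻²Q*B` on `Λ₅` (vector field:
*"aL⁻²Σ_{b∈st(Λ₅)} A(b₊)·(C^{(0)}_{Λ₅}Q*B)(b₋)"*; scalar field: *"aL⁻²Σ φ(b₊)·U(B^{(1)}_{−b})(C^{(0)}_{Λ₅}(B^{(1)})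
Q*(B^{(1)})ψ)(b₋)"*). [cite: Balaban1982Higgs2, (2.34) p.564] -/
noncomputable def bdryLin (C : Matrix (In p) (In p) ℝ) (st : Finset (In p × Out p)) (u : In p × Out p → ℝ)
    (g : In p → ℝ) (y : Out p → ℝ) : ℝ :=
  ∑ b ∈ st, y b.2 * u b * (C *ᵥ g) b.1

omit [DecidableEq S] in
/-- A sum against `𝒜_{ΛΛᶜ}y` is a sum over the supporting pairs `st`. [folklore] [cite: Balaban1982Higgs2, (2.29) p.563] -/
theorem sum_mul_blkMix_mulVec (M : Matrix S S ℝ) (st : Finset (In p × Out p))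
    (hst : ∀ i j, (i, j) ∉ st → blkMix p M i j = 0) (c : In p → ℝ) (y : Out p → ℝ) :
    ∑ i, c i * (blkMix p M *ᵥ y) i = ∑ b ∈ st, c b.1 * (blkMix p M b.1 b.2 * y b.2) := by
  calc ∑ i, c i * (blkMix p M *ᵥ y) i
      = ∑ i, ∑ j, c i * (blkMix p M i j * y j) := by
        refine Finset.sum_congr rfl fun i _ => ?_
        rw [mulVec, dotProduct, Finset.mul_sum]
    _ = ∑ b : In p × Out p, c b.1 * (blkMix p M b.1 b.2 * y b.2) :=
        (Fintype.sum_prod_type' (fun i j => c i * (blkMix p M i j * y j))).symm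
    _ = ∑ b ∈ st, c b.1 * (blkMix p M b.1 b.2 * y b.2) := by
        refine (Finset.sum_subset (Finset.subset_univ st) fun b _ hb => ?_).symm
        rw [hst b.1 b.2 hb, zero_mul, mul_zero]

omit [DecidableEq S] in
/-- `½⟨𝒜_{ΛΛᶜ}y, C𝒜_{ΛΛᶜ}y⟩ = ½Σ_{b,b′∈st} y(b₊)u_bC(b₋,b′₋)u_{b′}y(b′₊)` with `u_b = −𝒜(b₋, b₊)`.
[cite: Balaban1982Higgs2, (2.34) p.564] -/
theorem half_quad_blkMix_eq (M : Matrix S S ℝ) (st : Finset (In p × Out p))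
    (hst : ∀ i j, (i, j) ∉ st → blkMix p M i j = 0) (C : Matrix (In p) (In p) ℝ) (y : Out p → ℝ) :
    (1 / 2 : ℝ) * ((blkMix p M *ᵥ y) ⬝ᵥ (C *ᵥ (blkMix p M *ᵥ y)))
      = bdryQuad p C st (fun b => -blkMix p M b.1 b.2) y := by
  unfold bdryQuad
  congr 1
  have inner : ∀ k, (C *ᵥ (blkMix p M *ᵥ y)) k = ∑ b ∈ st, C k b.1 * (blkMix p M b.1 b.2 * y b.2) := by
    intro k
    show ∑ i, C k i * (blkMix p M *ᵥ y) i = _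
    exact sum_mul_blkMix_mulVec p M st hst (fun i => C k i) y
  calc (blkMix p M *ᵥ y) ⬝ᵥ (C *ᵥ (blkMix p M *ᵥ y))
      = ∑ i, (C *ᵥ (blkMix p M *ᵥ y)) i * (blkMix p M *ᵥ y) i := by
        rw [dotProduct_comm]
        rfl
    _ = ∑ b' ∈ st, (C *ᵥ (blkMix p M *ᵥ y)) b'.1 * (blkMix p M b'.1 b'.2 * y b'.2) :=
        sum_mul_blkMix_mulVec p M st hst _ y
    _ = ∑ b' ∈ st, ∑ b ∈ st,
          C b'.1 b.1 * (blkMix p M b.1 b.2 * y b.2) * (blkMix p M b'.1 b'.2 * y b'.2) := by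
        refine Finset.sum_congr rfl fun b' _ => ?_
        rw [inner, Finset.sum_mul]
    _ = ∑ b ∈ st, ∑ b' ∈ st, y b.2 * -blkMix p M b.1 b.2 * C b.1 b'.1 * -blkMix p M b'.1 b'.2 * y b'.2 := by
        refine Finset.sum_congr rfl fun b _ => Finset.sum_congr rfl fun b' _ => ?_
        ring

omit [DecidableEq S] in
/-- `−⟨𝒜_{ΛΛᶜ}y, Cg⟩ = Σ_{b∈st} y(b₊)u_b(Cg)(b₋)` with `u_b = −𝒜(b₋, b₊)`. [cite: Balaban1982Higgs2, (2.34) p.564] -/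
theorem neg_lin_blkMix_eq (M : Matrix S S ℝ) (st : Finset (In p × Out p))
    (hst : ∀ i j, (i, j) ∉ st → blkMix p M i j = 0) (C : Matrix (In p) (In p) ℝ) (g : In p → ℝ)
    (y : Out p → ℝ) :
    -((blkMix p M *ᵥ y) ⬝ᵥ (C *ᵥ g)) = bdryLin p C st (fun b => -blkMix p M b.1 b.2) g y := by
  unfold bdryLin
  rw [dotProduct_comm, dotProduct, sum_mul_blkMix_mulVec p M st hst (fun i => (C *ᵥ g) i) y,
    ← Finset.sum_neg_distrib]
  refine Finset.sum_congr rfl fun b _ => ?_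
  ring

omit [DecidableEq S] in
/-- `½⟨u − g, C(u − g)⟩ = ½⟨u, Cu⟩ − ⟨u, Cg⟩ + ½⟨g, Cg⟩` for symmetric `C`. [folklore] [cite: Balaban1982Higgs2, (2.34) p.564] -/
theorem half_quad_sub {ι : Type} [Fintype ι] (C : Matrix ι ι ℝ) (hC : C.IsSymm) (u g : ι → ℝ) :
    (1 / 2 : ℝ) * ((u - g) ⬝ᵥ (C *ᵥ (u - g)))
      = (1 / 2 : ℝ) * (u ⬝ᵥ (C *ᵥ u)) - u ⬝ᵥ (C *ᵥ g) + (1 / 2 : ℝ) * (g ⬝ᵥ (C *ᵥ g)) := by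
  have hsym : g ⬝ᵥ (C *ᵥ u) = u ⬝ᵥ (C *ᵥ g) := by
    have h := dotProduct_transpose_mulVec C g u
    rwa [hC.eq] at h
  rw [mulVec_sub, sub_dotProduct, dotProduct_sub, dotProduct_sub, hsym]
  ring

/-! ## §3 The main quadratic form with block averaging; the two exponents of (2.34) -/

variable {T : Type} [Fintype T] (pT : T → Prop) [DecidablePred pT]

omit [DecidablePred p] [DecidableEq S] [DecidablePred pT] in
/-- **The matrix of the main quadratic form**, `𝒜 = D + κ·Qm·Qmᵀ` ↤ `Δ^{(0)} + aL⁻²P` (vector: `(−Δ + μ₀²ε²) + aL⁻²Q*Q`;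
part I (2.32): the operator whose Dirichlet restrictions give the covariances `C^{(0)}_Λ`).
[cite: Balaban1982Higgs2, (2.34) p.564] -/
noncomputable def mainOp (κ : ℝ) (Qm : Matrix S T ℝ) (D : Matrix S S ℝ) : Matrix S S ℝ := D + κ • (Qm * Qmᵀ)

omit [DecidablePred p] [DecidableEq S] [DecidablePred pT] in
/-- **The exponent of the FIRST representation in (2.34)**, one field species:
`−½aL^{d−2}Σ_{y∈T′₁}|B(y) − (QA)(y)|² − ½⟨A, (−Δ + μ₀²ε²)A⟩` ↦ `−½κΣ_t (B_t − (QmᵀA)_t)² − ½⟨A, DA⟩` (and the same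
display for the scalar field with `ψ`, `Q(B̃^{(1)})`, `−Δ_{B̃^{(1)}} + m²ε²`). [cite: Balaban1982Higgs2, (2.34) p.564] -/
noncomputable def firstExp (κ : ℝ) (Qm : Matrix S T ℝ) (D : Matrix S S ℝ) (B : T → ℝ) (φ : S → ℝ) : ℝ :=
  -(1 / 2 : ℝ) * κ * ∑ t, (B t - (Qmᵀ *ᵥ φ) t) ^ 2 - (1 / 2 : ℝ) * (φ ⬝ᵥ (D *ᵥ φ))

omit [DecidablePred p] [DecidableEq S] [DecidablePred pT] in
/-- Expanding the square: `firstExp = −½κΣ_tB_t² + ⟨κQmB, A⟩ − ½⟨A, 𝒜A⟩`. [folklore] [cite: Balaban1982Higgs2, (2.34) p.564] -/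
theorem firstExp_eq (κ : ℝ) (Qm : Matrix S T ℝ) (D : Matrix S S ℝ) (B : T → ℝ) (φ : S → ℝ) :
    firstExp κ Qm D B φ
      = -(1 / 2 : ℝ) * κ * ∑ t, B t ^ 2 + ∑ s, (κ • (Qm *ᵥ B)) s * φ s
          - (1 / 2 : ℝ) * (φ ⬝ᵥ (mainOp κ Qm D *ᵥ φ)) := by
  have hsq : ∑ t, (B t - (Qmᵀ *ᵥ φ) t) ^ 2
      = ∑ t, B t ^ 2 - 2 * (B ⬝ᵥ (Qmᵀ *ᵥ φ)) + (Qmᵀ *ᵥ φ) ⬝ᵥ (Qmᵀ *ᵥ φ) := by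
    simp only [dotProduct, Finset.mul_sum, ← Finset.sum_sub_distrib, ← Finset.sum_add_distrib]
    exact Finset.sum_congr rfl fun t _ => by ring
  have h1 : B ⬝ᵥ (Qmᵀ *ᵥ φ) = φ ⬝ᵥ (Qm *ᵥ B) := dotProduct_transpose_mulVec Qm B φ
  have h2 : (Qmᵀ *ᵥ φ) ⬝ᵥ (Qmᵀ *ᵥ φ) = φ ⬝ᵥ ((Qm * Qmᵀ) *ᵥ φ) := by
    rw [← mulVec_mulVec]
    exact dotProduct_transpose_mulVec Qm (Qmᵀ *ᵥ φ) φ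
  have h3 : ∑ s, (κ • (Qm *ᵥ B)) s * φ s = κ * (φ ⬝ᵥ (Qm *ᵥ B)) := by
    simp only [Pi.smul_apply, smul_eq_mul, dotProduct, Finset.mul_sum]
    exact Finset.sum_congr rfl fun s _ => by ring
  rw [firstExp, hsq, h1, h2, h3, mainOp, add_mulVec, dotProduct_add, smul_mulVec, dotProduct_smul,
    smul_eq_mul]
  ring

omit [DecidablePred p] [DecidableEq S] [DecidablePred pT] in
/-- The first-representation integrand as a Gaussian weight with a source:
`e^{firstExp(B, A)} = e^{−½κΣ_tB_t²}·(e^{−½⟨A,𝒜A⟩}·e^{⟨κQmB, A⟩})`. [cite: Balaban1982Higgs2, (2.34) p.564] -/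
theorem exp_firstExp (κ : ℝ) (Qm : Matrix S T ℝ) (D : Matrix S S ℝ) (B : T → ℝ) (φ : S → ℝ) :
    Real.exp (firstExp κ Qm D B φ)
      = Real.exp (-(1 / 2 : ℝ) * κ * ∑ t, B t ^ 2)
          * (weight (mainOp κ Qm D) φ * source (κ • (Qm *ᵥ B)) φ) := by
  rw [firstExp_eq, weight, source, ← Real.exp_add, ← Real.exp_add]
  congr 1
  ring

/-! ### Block bookkeeping: `Λ₅` is a union of blocks (`hQ`) -/

omit [DecidableEq S] [Fintype T] [DecidablePred pT] in
/-- A block inside `Λ₅` averages the `Λ₅`-part of the field only: for `t ∈ Λ′₅`,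
`(Q(x on Λ₅, y on Λ₅ᶜ))(t) = (Q(x on Λ₅, 0))(t)`. [folklore] [cite: Balaban1982Higgs1, (2.32) p.611] -/
theorem avg_glue_of_in (Qm : Matrix S T ℝ) (hQ : ∀ s t, Qm s t ≠ 0 → (p s ↔ pT t)) (x : In p → ℝ)
    (y : Out p → ℝ) {t : T} (ht : pT t) : (Qmᵀ *ᵥ glue p x y) t = (Qmᵀ *ᵥ glue p x 0) t := by
  simp only [mulVec, dotProduct, transpose_apply]
  rw [sum_split p, sum_split p]
  simp only [glue_apply_in, glue_apply_out, Pi.zero_apply, mul_zero, Finset.sum_const_zero, add_zero]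
  rw [add_eq_left]
  refine Finset.sum_eq_zero fun j _ => ?_
  by_cases h : Qm j.1 t = 0
  · rw [h, zero_mul]
  · exact absurd ((hQ j.1 t h).2 ht) j.2

omit [DecidableEq S] [Fintype T] [DecidablePred pT] in
/-- A block outside `Λ₅` averages the `Λ₅ᶜ`-part of the field only: for `t ∉ Λ′₅`,
`(Q(x on Λ₅, y on Λ₅ᶜ))(t) = (Q(0, y on Λ₅ᶜ))(t)`. [folklore] [cite: Balaban1982Higgs1, (2.32) p.611] -/
theorem avg_glue_of_out (Qm : Matrix S T ℝ) (hQ : ∀ s t, Qm s t ≠ 0 → (p s ↔ pT t)) (x : In p → ℝ)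
    (y : Out p → ℝ) {t : T} (ht : ¬ pT t) : (Qmᵀ *ᵥ glue p x y) t = (Qmᵀ *ᵥ glue p 0 y) t := by
  simp only [mulVec, dotProduct, transpose_apply]
  rw [sum_split p, sum_split p]
  simp only [glue_apply_in, glue_apply_out, Pi.zero_apply, mul_zero, Finset.sum_const_zero, zero_add]
  rw [add_eq_right]
  refine Finset.sum_eq_zero fun i _ => ?_
  by_cases h : Qm i.1 t = 0
  · rw [h, zero_mul]
  · exact absurd i.2 (fun hi => ht ((hQ i.1 t h).1 hi))

omit [DecidableEq S] [Fintype T] [DecidablePred pT] in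
/-- In particular the zero field on `Λ₅` has zero averages over the inner blocks. [folklore] [cite: Balaban1982Higgs1, (2.32) p.611] -/
theorem avg_glue_zero_of_in (Qm : Matrix S T ℝ) (hQ : ∀ s t, Qm s t ≠ 0 → (p s ↔ pT t)) (y : Out p → ℝ)
    {t : T} (ht : pT t) : (Qmᵀ *ᵥ glue p 0 y) t = 0 := by
  rw [avg_glue_of_in p pT Qm hQ 0 y ht]
  have h0 : glue p (0 : In p → ℝ) (0 : Out p → ℝ) = 0 := by
    funext s
    by_cases hs : p s <;> simp [glue, hs]
  rw [h0, mulVec_zero, Pi.zero_apply]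

omit [Fintype S] [DecidablePred p] [DecidableEq S] [DecidablePred pT] in
/-- `Q*Q` does not couple `Λ₅` to `Λ₅ᶜ` (every block lies inside or outside). [folklore] [cite: Balaban1982Higgs1, (2.32) p.611] -/
theorem blkMix_avg (Qm : Matrix S T ℝ) (hQ : ∀ s t, Qm s t ≠ 0 → (p s ↔ pT t)) :
    blkMix p (Qm * Qmᵀ) = 0 := by
  ext i j
  simp only [blkMix, submatrix_apply, mul_apply, transpose_apply, Matrix.zero_apply]
  refine Finset.sum_eq_zero fun t _ => ?_
  by_cases hi : Qm i.1 t = 0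
  · rw [hi, zero_mul]
  by_cases hj : Qm j.1 t = 0
  · rw [hj, mul_zero]
  exact absurd (((hQ i.1 t hi).trans (hQ j.1 t hj).symm).1 i.2) j.2

omit [Fintype S] [DecidablePred p] [DecidableEq S] [DecidablePred pT] in
/-- Hence the `Λ₅Λ₅ᶜ`-block of the main operator is that of `D` (the Laplacian's boundary couplings only).
[folklore] [cite: Balaban1982Higgs2, (2.34) p.564] -/
theorem blkMix_mainOp (κ : ℝ) (Qm : Matrix S T ℝ) (D : Matrix S S ℝ) (hQ : ∀ s t, Qm s t ≠ 0 → (p s ↔ pT t)) :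
    blkMix p (mainOp κ Qm D) = blkMix p D := by
  have h : blkMix p (mainOp κ Qm D) = blkMix p D + κ • blkMix p (Qm * Qmᵀ) := by
    ext i j
    simp [blkMix, mainOp, submatrix_apply, Matrix.add_apply, Matrix.smul_apply]
  rw [h, blkMix_avg p pT Qm hQ, smul_zero, add_zero]

omit [DecidablePred p] [DecidableEq S] in
/-- `⟨A, Q*Q A⟩ = Σ_t (QA)_t²`. [folklore] [cite: Balaban1982Higgs2, (2.34) p.564] -/
theorem quadForm_avg (Qm : Matrix S T ℝ) (φ : S → ℝ) :
    φ ⬝ᵥ ((Qm * Qmᵀ) *ᵥ φ) = ∑ t, (Qmᵀ *ᵥ φ) t ^ 2 := by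
  rw [← mulVec_mulVec, ← dotProduct_transpose_mulVec Qm (Qmᵀ *ᵥ φ) φ, dotProduct]
  exact Finset.sum_congr rfl fun t _ => by ring

/-! ### The Dirichlet reading of the restricted operators (part I (2.32)) -/

omit [DecidableEq S] in
/-- **`⟨y, D↾_{Λᶜ}y⟩ = ⟨ỹ, Dỹ⟩` with `ỹ = y` extended by `0` on `Λ`** — the Dirichlet restriction of part I (2.32)
(*"A↾_Λφ = ΛAΛφ"*): `blkOut p D` ↤ `−Δ^D_{Λ₅ᶜ} + μ₀²ε²` of (2.34) is the form of the field vanishing on `Λ₅`.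
[cite: Balaban1982Higgs1, (2.32) p.611] -/
theorem quadForm_blkOut (D : Matrix S S ℝ) (y : Out p → ℝ) :
    y ⬝ᵥ (blkOut p D *ᵥ y) = glue p 0 y ⬝ᵥ (D *ᵥ glue p 0 y) := by
  rw [quadForm_glue]
  simp

omit [DecidableEq S] in
/-- `⟨f↾_{Λᶜ}, y⟩ = ⟨f, ỹ⟩`, `ỹ = y` extended by `0`. [folklore] [cite: Balaban1982Higgs2, (2.34) p.564] -/
theorem resOut_dotProduct (f : S → ℝ) (y : Out p → ℝ) : resOut p f ⬝ᵥ y = f ⬝ᵥ glue p 0 y := by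
  rw [dotProduct_comm f, dotProduct, dotProduct, sum_split p]
  simp [resOut, mul_comm]

/-! ### (2.27) and the exponent of the second representation -/

/-- **The bracket `⟨B, Δ^{(1),L}_Λ B⟩` of (2.27)** p. 562 in these coordinates (verbatim: *"⟨ψ, Δ^{(k+1),L}_Λ(Ω, A)ψ⟩ =
aL^{d−2}Σ_{y∈Λ′}|ψ(y)|² − a²L⁻⁴⟨ψ, Q(A)C^{(k)}_Λ(Ω, A)Q*(A)ψ⟩, Λ ⊂ Ω^{(k)}, (2.27) and the similar formula holds for the
vector field"*): `κΣ_{t∈Λ′}B_t² − ⟨(κQmB)↾_Λ, C^{(0)}_Λ (κQmB)↾_Λ⟩` (`κQmB` ↤ `aL⁻²Q*B`; the B2-located definition of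
the operator Δ^{(1),L}_Λ itself is row B2.Eq2.42 member (2.27), r02). [cite: Balaban1982Higgs2, (2.27) p.562] -/
noncomputable def form227 (κ : ℝ) (Qm : Matrix S T ℝ) (D : Matrix S S ℝ) (B : T → ℝ) : ℝ :=
  κ * ∑ t ∈ univ.filter (fun t => pT t), B t ^ 2
    - resIn p (κ • (Qm *ᵥ B)) ⬝ᵥ (cov p (mainOp κ Qm D) *ᵥ resIn p (κ • (Qm *ᵥ B)))

/-- A `Λ × Λ` kernel (e.g. `C^{(0)}_Λ`) as a kernel on `Ω × Ω`, zero off `Λ × Λ` — the way part I's conditioned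
covariances act on configurations on the whole lattice. [cite: Balaban1982Higgs1, (2.32) p.611] -/
def extIn (M : Matrix (In p) (In p) ℝ) : Matrix S S ℝ :=
  fun s s' => if h : p s ∧ p s' then M ⟨s, h.1⟩ ⟨s', h.2⟩ else 0

omit [DecidableEq S] in
/-- The form of the extended kernel is the form of the kernel on the restrictions: `⟨g, M̃g⟩ = ⟨g↾_Λ, M g↾_Λ⟩`.
[folklore] [cite: Balaban1982Higgs1, (2.32) p.611] -/
theorem dotProduct_extIn_mulVec (M : Matrix (In p) (In p) ℝ) (g : S → ℝ) :
    g ⬝ᵥ (extIn p M *ᵥ g) = resIn p g ⬝ᵥ (M *ᵥ resIn p g) := by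
  have hrow : ∀ s, (extIn p M *ᵥ g) s = if h : p s then (M *ᵥ resIn p g) ⟨s, h⟩ else 0 := by
    intro s
    by_cases hs : p s
    · rw [dif_pos hs, mulVec, dotProduct, mulVec, dotProduct, sum_split p]
      have h0 : ∑ j : Out p, extIn p M s j * g j = 0 :=
        Finset.sum_eq_zero fun j _ => by simp [extIn, j.2]
      rw [h0, add_zero]
      exact Finset.sum_congr rfl fun i _ => by simp [extIn, hs, i.2, resIn]
    · rw [dif_neg hs, mulVec, dotProduct]
      exact Finset.sum_eq_zero fun s' _ => by simp [extIn, hs]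
  rw [dotProduct, sum_split p]
  have h0 : ∑ j : Out p, g j * (extIn p M *ᵥ g) j = 0 :=
    Finset.sum_eq_zero fun j _ => by rw [hrow, dif_neg j.2, mul_zero]
  rw [h0, add_zero, dotProduct]
  exact Finset.sum_congr rfl fun i _ => by rw [hrow, dif_pos i.2]; rfl

/-- **(2.27) by name**: `form227` is the quadratic form `⟨B, Δ^{(1),L}_{Λ₅}B⟩` of r02's B2-located operator
`B2Eq224FirstStepFields.delta227` (the DEFINITION of Δ^{(k+1),L}_Λ, row B2.Eq2.42 member (2.27)) taken at `c = κ`,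
`Λ′ = Λ′₅`, `Q = Qmᵀ`, `Qs = Qm`, `CΛ = C^{(0)}_{Λ₅}` extended by zero, in plain sums (`w = 1`; cf.
`B2Eq224FirstStepFields.form227`). [cite: Balaban1982Higgs2, (2.27) p.562] -/
theorem form227_eq_delta227 [DecidableEq T] (κ : ℝ) (Qm : Matrix S T ℝ) (D : Matrix S S ℝ) (B : T → ℝ) :
    form227 p pT κ Qm D B
      = B ⬝ᵥ (B2Eq224FirstStepFields.delta227 κ (univ.filter (fun t => pT t)) Qmᵀ
          (extIn p (cov p (mainOp κ Qm D))) Qm *ᵥ B) := by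
  have h := B2Eq224FirstStepFields.form227 κ 1 (univ.filter (fun t => pT t)) Qmᵀ
    (extIn p (cov p (mainOp κ Qm D))) Qm B
  rw [one_mul, mul_one, one_mul] at h
  rw [h, form227]
  have h2 : B ⬝ᵥ ((Qmᵀ * extIn p (cov p (mainOp κ Qm D)) * Qm) *ᵥ B)
      = resIn p (Qm *ᵥ B) ⬝ᵥ (cov p (mainOp κ Qm D) *ᵥ resIn p (Qm *ᵥ B)) := by
    rw [← mulVec_mulVec, ← mulVec_mulVec, dotProduct_transpose_mulVec, dotProduct_comm,
      dotProduct_extIn_mulVec]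
  have h3 : resIn p (κ • (Qm *ᵥ B)) = κ • resIn p (Qm *ᵥ B) := rfl
  rw [h2, h3, mulVec_smul, smul_dotProduct, dotProduct_smul, smul_eq_mul, smul_eq_mul]
  ring

/-- **The exponent of the SECOND representation in (2.34)**, one field species, term by term as printed:
`−½aL^{d−2}Σ_{y∈Λ₅ᶜ}|B(y) − (QA)(y)|²` (outer blocks; `A` ↤ the field `y` on `Λ₅ᶜ` extended by `0`)
`− ½⟨A, (−Δ^D_{Λ₅ᶜ} + μ₀²ε²)A⟩` (`= −½⟨y, D↾_{Λ₅ᶜ}y⟩`, `quadForm_blkOut`)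
`+ ½Σ_{b,b′∈st(Λ₅)} A(b₊)·u_b C^{(0)}_{Λ₅}(b₋, b′₋) u_{b′}·A(b′₊)` (`bdryQuad`, `u_b = −D(b₋, b₊)`; `= 1` for the vector field)
`+ Σ_{b∈st(Λ₅)} A(b₊)·u_b (C^{(0)}_{Λ₅}(aL⁻²Q*B))(b₋)` (`bdryLin`)
`− ½⟨B, Δ^{(1),L}_{Λ₅}B⟩` (`form227`). [cite: Balaban1982Higgs2, (2.34) p.564] -/
noncomputable def secondExp (κ : ℝ) (Qm : Matrix S T ℝ) (D : Matrix S S ℝ) (st : Finset (In p × Out p))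
    (B : T → ℝ) (y : Out p → ℝ) : ℝ :=
  -(1 / 2 : ℝ) * κ * ∑ t ∈ univ.filter (fun t => ¬ pT t), (B t - (Qmᵀ *ᵥ glue p 0 y) t) ^ 2
    - (1 / 2 : ℝ) * (y ⬝ᵥ (blkOut p D *ᵥ y))
    + bdryQuad p (cov p (mainOp κ Qm D)) st (fun b => -blkMix p D b.1 b.2) y
    + bdryLin p (cov p (mainOp κ Qm D)) st (fun b => -blkMix p D b.1 b.2) (resIn p (κ • (Qm *ᵥ B))) y
    - (1 / 2 : ℝ) * form227 p pT κ Qm D B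

omit [DecidableEq S] in
/-- The outer-block part of the completed square: with `v = Q(ỹ)`, `ỹ = y` extended by `0` on `Λ₅`,
`−½κΣ_{t∉Λ′₅}B_t² − ½κ⟨ỹ, Q*Qỹ⟩ + κ⟨QmB, ỹ⟩ = −½κΣ_{t∉Λ′₅}(B_t − v_t)²` (the inner blocks of `ỹ` average to `0`).
[folklore] [cite: Balaban1982Higgs2, (2.34) p.564] -/
theorem outer_square (κ : ℝ) (Qm : Matrix S T ℝ) (hQ : ∀ s t, Qm s t ≠ 0 → (p s ↔ pT t)) (B : T → ℝ)
    (y : Out p → ℝ) :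
    -(1 / 2 : ℝ) * κ * ∑ t ∈ univ.filter (fun t => ¬ pT t), B t ^ 2
        - (1 / 2 : ℝ) * κ * (glue p 0 y ⬝ᵥ ((Qm * Qmᵀ) *ᵥ glue p 0 y))
        + κ * ((Qm *ᵥ B) ⬝ᵥ glue p 0 y)
      = -(1 / 2 : ℝ) * κ * ∑ t ∈ univ.filter (fun t => ¬ pT t), (B t - (Qmᵀ *ᵥ glue p 0 y) t) ^ 2 := by
  set v : T → ℝ := Qmᵀ *ᵥ glue p 0 y with hv
  have hin : ∀ t ∈ univ.filter (fun t => pT t), v t = 0 := by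
    intro t ht
    rw [Finset.mem_filter] at ht
    exact avg_glue_zero_of_in p pT Qm hQ y ht.2
  have hQQ : glue p 0 y ⬝ᵥ ((Qm * Qmᵀ) *ᵥ glue p 0 y) = ∑ t ∈ univ.filter (fun t => ¬ pT t), v t ^ 2 := by
    rw [quadForm_avg, ← Finset.sum_filter_add_sum_filter_not univ (fun t => pT t)]
    rw [Finset.sum_eq_zero (fun t ht => by rw [← hv, hin t ht]; ring), zero_add]
  have hQB : (Qm *ᵥ B) ⬝ᵥ glue p 0 y = ∑ t ∈ univ.filter (fun t => ¬ pT t), B t * v t := by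
    have h1 : (Qm *ᵥ B) ⬝ᵥ glue p 0 y = B ⬝ᵥ v := by
      rw [hv, dotProduct_transpose_mulVec Qm B (glue p 0 y), dotProduct_comm]
    rw [h1, dotProduct, ← Finset.sum_filter_add_sum_filter_not univ (fun t => pT t)]
    rw [Finset.sum_eq_zero (fun t ht => by rw [hin t ht, mul_zero]), zero_add]
  rw [hQQ, hQB]
  have : ∑ t ∈ univ.filter (fun t => ¬ pT t), (B t - v t) ^ 2
      = ∑ t ∈ univ.filter (fun t => ¬ pT t), B t ^ 2 - 2 * ∑ t ∈ univ.filter (fun t => ¬ pT t), B t * v t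
          + ∑ t ∈ univ.filter (fun t => ¬ pT t), v t ^ 2 := by
    rw [Finset.mul_sum, ← Finset.sum_sub_distrib, ← Finset.sum_add_distrib]
    exact Finset.sum_congr rfl fun t _ => by ring
  rw [this]
  ring

/-- **The pointwise identity behind (2.34)**: at exterior field `y = A↾_{Λ₅ᶜ}`,
`−½κΣ_tB_t² + log K(y) = secondExp(B, y)` — the completed square `½⟨j(y), C^{(0)}_{Λ₅}j(y)⟩`,
`j(y) = D_{Λ₅Λ₅ᶜ}y − (aL⁻²Q*B)↾_{Λ₅}`, splits into the two boundary sums and `½⟨(aL⁻²Q*B)↾_{Λ₅}, C^{(0)}_{Λ₅}(…)⟩`, which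
with `−½aL^{d−2}Σ_{y∈Λ′₅}|B|²` is `−½⟨B, Δ^{(1),L}_{Λ₅}B⟩`; the outer blocks recombine into `−½aL^{d−2}Σ_{Λ₅ᶜ}|B − QA|²`.
[cite: Balaban1982Higgs2, (2.34) p.564] -/
theorem exponent_identity (κ : ℝ) (Qm : Matrix S T ℝ) (D : Matrix S S ℝ) (h𝒜 : (mainOp κ Qm D).PosDef)
    (hQ : ∀ s t, Qm s t ≠ 0 → (p s ↔ pT t)) (st : Finset (In p × Out p))
    (hst : ∀ i j, (i, j) ∉ st → blkMix p D i j = 0) (B : T → ℝ) (y : Out p → ℝ) :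
    -(1 / 2 : ℝ) * κ * ∑ t, B t ^ 2
        + (cOut p (mainOp κ Qm D) (κ • (Qm *ᵥ B)) y
          + 1 / 2 * (jIn p (mainOp κ Qm D) (κ • (Qm *ᵥ B)) y
              ⬝ᵥ (cov p (mainOp κ Qm D) *ᵥ jIn p (mainOp κ Qm D) (κ • (Qm *ᵥ B)) y)))
      = secondExp p pT κ Qm D st B y := by
  -- the exterior constant
  have hcOut : cOut p (mainOp κ Qm D) (κ • (Qm *ᵥ B)) y
      = -(1 / 2 : ℝ) * (y ⬝ᵥ (blkOut p D *ᵥ y))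
          - (1 / 2 : ℝ) * κ * (glue p 0 y ⬝ᵥ ((Qm * Qmᵀ) *ᵥ glue p 0 y)) + κ * ((Qm *ᵥ B) ⬝ᵥ glue p 0 y) := by
    have h1 : y ⬝ᵥ (blkOut p (mainOp κ Qm D) *ᵥ y)
        = y ⬝ᵥ (blkOut p D *ᵥ y) + κ * (glue p 0 y ⬝ᵥ ((Qm * Qmᵀ) *ᵥ glue p 0 y)) := by
      rw [quadForm_blkOut, quadForm_blkOut, mainOp, add_mulVec, dotProduct_add, smul_mulVec, dotProduct_smul,
        smul_eq_mul]
    have h2 : resOut p (κ • (Qm *ᵥ B)) ⬝ᵥ y = κ * ((Qm *ᵥ B) ⬝ᵥ glue p 0 y) := by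
      rw [resOut_dotProduct, smul_dotProduct, smul_eq_mul]
    rw [cOut, h1, h2]
    ring
  -- the completed square
  have hjIn : jIn p (mainOp κ Qm D) (κ • (Qm *ᵥ B)) y = blkMix p D *ᵥ y - resIn p (κ • (Qm *ᵥ B)) := by
    rw [jIn, blkMix_mainOp p pT κ Qm D hQ]
  have hCs : (cov p (mainOp κ Qm D)).IsSymm := isSymm_cov p h𝒜
  have hsq : 1 / 2 * (jIn p (mainOp κ Qm D) (κ • (Qm *ᵥ B)) y
        ⬝ᵥ (cov p (mainOp κ Qm D) *ᵥ jIn p (mainOp κ Qm D) (κ • (Qm *ᵥ B)) y))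
      = bdryQuad p (cov p (mainOp κ Qm D)) st (fun b => -blkMix p D b.1 b.2) y
        + bdryLin p (cov p (mainOp κ Qm D)) st (fun b => -blkMix p D b.1 b.2) (resIn p (κ • (Qm *ᵥ B))) y
        + (1 / 2 : ℝ) * (resIn p (κ • (Qm *ᵥ B))
            ⬝ᵥ (cov p (mainOp κ Qm D) *ᵥ resIn p (κ • (Qm *ᵥ B)))) := by
    rw [hjIn, half_quad_sub (cov p (mainOp κ Qm D)) hCs, half_quad_blkMix_eq p D st hst (cov p (mainOp κ Qm D)) y,
      ← neg_lin_blkMix_eq p D st hst (cov p (mainOp κ Qm D)) (resIn p (κ • (Qm *ᵥ B))) y]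
    ring
  -- the inner / outer blocks
  have hsplit : ∑ t, B t ^ 2
      = ∑ t ∈ univ.filter (fun t => pT t), B t ^ 2 + ∑ t ∈ univ.filter (fun t => ¬ pT t), B t ^ 2 :=
    (Finset.sum_filter_add_sum_filter_not univ (fun t => pT t) _).symm
  have ho := outer_square p pT κ Qm hQ B y
  rw [hcOut, hsq, hsplit, secondExp, form227]
  linear_combination ho


end Literature.MathematicalPhysics.QuantumFieldTheory.Balaban1983to89.B2Eq234Exponent
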